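import Literature.Analysis.FluidPDE.PassiveVectorTensorDistortedConstFrameGalerkinIdentity
import Literature.Analysis.FluidPDE.PassiveVectorTensorEnergyDecay
import HarnessLib

/-!
# The distorted weak class with a CONSTANT non-degenerate frame, a coercive tensor and a bounded
# carrier: energy equality (limit form), energy inequality and exponential decay of EVERY weak
# solution (frozen-frame twin of `PassiveVectorTensorEnergyDecay`)

Analysis/FluidPDE proof-support file (everything proved; no definitions, no named facts). Fifth and last
brick (layer L3, file 5/5) of the Fourier–Galerkin energy argument ON THE WEAK SOLUTION ITSELF for the
constant-frame distorted class `Torus.IsWeakTensorPassiveVectorDistortedOn 0 T 𝔸 b (fun _ _ => G₀) w₀ w`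
(`∂ₜw + (b·∇)w + G₀ᵀ∇π = 𝓛^{G₀} w`, `∇·(G₀ w) = 0`; `A = 0`) with a constant tensor in a Legendre–Hadamard
window `NearIso 𝔸 lo hi`, `0 < lo` (NO symmetry of `𝔸`), a NON-DEGENERATE frame (`c|k|² ≤ |G₀ᵀk|²` for all
`k`, `0 < c`; `c = (1 − card d·θ)²` for `|G₀ − 1| ≤ θ` entrywise), a carrier `b ∈ L^∞((0,T) × T^d)` and a
datum `w₀ ∈ L²` with `∇·(G₀ w₀) = 0` weakly.  The limit `N → ∞` in the truncated identity
`…ConstFrameGalerkinIdentity.ae_sum_sq_norm_mFourierCoeff_eq_constFrame` gives: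

* **`ae_tendsto_setIntegral_symbForm_constFrame`** — the integrated truncated TWISTED symbol forms
  converge: `∫_{(0,t]} Q_N → (‖w₀‖² − ‖w(t)‖²)/2` for a.e. `t`
  (`Q_N(s) = 4π² ∑_{|k|≤N} Re ⟪ŵ(s)(k), T_{𝔸^{G₀}}(k)ŵ(s)(k)⟫`, `T_{𝔸^{G₀}} = symbT (Visc4.conj G₀ 𝔸)`; the
  transport remainder `→ 0` in `L¹(0,T)` exactly as in the flat energy equality, Robinson–Rodrigo–Sadowski
  2016, (4.20); Temam 1984, Ch. III Lemma 1.2) — the **energy equality with the twisted tensor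
  dissipation** `2 lim_N ∫₀ᵗ Q_N`;
* **`ae_energy_ineq_constFrame`** — the energy inequality with the twisted coercivity constant: for a.e.
  `t ∈ (0,T)`, `‖w(t)‖²_{L²} + 2 (lo c) ∫₀ᵗ ‖∇w‖²_{L²} ≤ ‖w₀‖²_{L²}` (in `[0,∞]`,
  `Torus.eVectorDissipation (lo * c)`);
* **`ae_integral_norm_sq_le_exp_constFrame`** — exponential decay for mean-zero data: if `∫ w₀ = 0`
  then for a.e. `t ∈ (0,T)`, `‖w(t)‖²_{L²} ≤ exp(−8π² (lo c) t) ‖w₀‖²_{L²}` (the zero mode is conserved, the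
  twisted symbol form dominates `4π² (lo c) ∑_{k≠0} ‖ŵ(k)‖²`, and the continuous representative
  `t ↦ ‖w₀‖² − 2∫₀ᵗ Q` of the energy obeys `E(t₂)(1 + 8π²(lo c)(t₂ − t₁)) ≤ E(t₁)`).

With the flat files cited by name this completes layer L3 of the road of record D28-7 (cell `ad-ideate`,
route `SolenoidalFractalHomogenisation`, K1L_D stmt-AnomalousDissipation-27980, registered stub
`stub_D1_V0θg`): the regularity interface consumed by the Summit-side energy representative
(`CellChain.exists_energyRep`: `integrableOn_symbForm`, `ae_symbForm_mono`, `ae_re_inner_symbT_nonneg`,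
`ae_tendsto_setIntegral_symbForm`, `ae_energy_ineq`, transversality + coercivity per mode) now has
constant-frame twins with the dictionary `symbT 𝔹 k ↦ symbT (Visc4.conj G₀ 𝔹) k`,
`k·z = 0 ↦ rdot (twistFreq G₀ k) z = 0`, `lo|k|² ↦ lo|G₀ᵀk|² ≥ (lo c)|k|²`.  Armstrong–Vicol's
Lagrangian-coordinate ansatz with the distortion frozen (arXiv:2305.05048 §4.1).

## Mathlib / tree search

Tree: `PassiveVectorTensorEnergyDecay` (flat twin, verbatim up to the substitutions),
`PassiveVectorTensorDistortedConstFrameGalerkinIdentity` / `…GalerkinTail` / `…DissipationBound` /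
`…ModeEnergy` (this layer), `TorusHNegOnePairing` (`mFourierCoeff_complexify_zero_of_hasZeroMean`),
`TorusVectorParseval` (`hasSum_sq_norm_mFourierCoeff_complexify`), `PassiveScalarEnergyProofs`
(`ae_ae_norm_le_of_memLp_top_stLift`). Mathlib: `Real.tendsto_one_add_div_pow_exp`, `lintegral_iSup'`,
`AntitoneOn.integrableOn_isCompact`.

## References

* R. Temam, *Navier–Stokes Equations*, 3rd ed. (North-Holland 1984), Ch. III §1, Lemma 1.2. [`Temam1984`]
* J. C. Robinson, J. L. Rodrigo, W. Sadowski, *The three-dimensional Navier–Stokes equations*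
  (CUP 2016), §4.2 (4.20), Lemma 4.1. [`RobinsonRodrigoSadowski2016`]
* S. Armstrong, V. Vicol, *Anomalous diffusion by fractal homogenization*, Ann. PDE 11 (2025) /
  arXiv:2305.05048, §4.1 (PDF p. 34). [`ArmstrongVicol2025`]
* U. Frisch, *Turbulence* (CUP 1995), §9.6.3 eq. (9.57) p. 233. [`Frisch1995Turbulence`]
* M. Giaquinta, *Multiple integrals in the calculus of variations and nonlinear elliptic systems*
  (Princeton 1983), Ch. III §2 (2.2). [`Giaquinta1983MultipleIntegrals`]
-/

noncomputable section

open MeasureTheory Set Filter Function TopologicalSpace Complex UnitAddTorus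
open scoped ENNReal NNReal InnerProductSpace Topology ComplexConjugate

namespace Literature.Analysis.FluidPDE

namespace Torus

variable {d : Type*} [Fintype d] [DecidableEq d]

/-! ## Real-variable lemmas (verbatim from the flat file) -/

section RealLemmas

omit [Fintype d] [DecidableEq d] in
/-- **Cauchy–Schwarz for square roots**: `∫ √f √g ≤ √(∫ f) √(∫ g)` for nonnegative integrable `f, g`.
[folklore] -/
private theorem integral_sqrt_mul_sqrt_le_cf {α : Type*} [MeasurableSpace α] {μ : Measure α} {f g : α → ℝ}
    (hf : Integrable f μ) (hg : Integrable g μ) (hf0 : 0 ≤ᵐ[μ] f) (hg0 : 0 ≤ᵐ[μ] g) :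
    ∫ x, Real.sqrt (f x) * Real.sqrt (g x) ∂μ ≤ Real.sqrt (∫ x, f x ∂μ) * Real.sqrt (∫ x, g x ∂μ) := by
  have hmem : ∀ {φ : α → ℝ}, Integrable φ μ → 0 ≤ᵐ[μ] φ →
      MemLp (fun x => Real.sqrt (φ x)) (ENNReal.ofReal 2) μ := by
    intro φ hφ hφ0
    rw [show ENNReal.ofReal 2 = 2 by simp]
    refine (memLp_two_iff_integrable_sq (Real.continuous_sqrt.comp_aestronglyMeasurable hφ.1)).2 ?_
    refine hφ.congr ?_
    filter_upwards [hφ0] with x hx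
    rw [Real.sq_sqrt hx]
  have h := integral_mul_le_Lp_mul_Lq_of_nonneg Real.HolderConjugate.two_two
    (ae_of_all _ fun x => Real.sqrt_nonneg (f x)) (ae_of_all _ fun x => Real.sqrt_nonneg (g x)) (hmem hf hf0) (hmem hg hg0)
  have e1 : ∫ x, Real.sqrt (f x) ^ (2 : ℝ) ∂μ = ∫ x, f x ∂μ := by
    refine integral_congr_ae ?_
    filter_upwards [hf0] with x hx
    rw [Real.rpow_two, Real.sq_sqrt hx]
  have e2 : ∫ x, Real.sqrt (g x) ^ (2 : ℝ) ∂μ = ∫ x, g x ∂μ := by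
    refine integral_congr_ae ?_
    filter_upwards [hg0] with x hx
    rw [Real.rpow_two, Real.sq_sqrt hx]
  rw [e1, e2] at h
  simpa [Real.sqrt_eq_rpow] using h

omit [Fintype d] [DecidableEq d] in
/-- Squeeze: if `|xₙ| ≤ yₙ` and `yₙ → 0` then `xₙ → 0`. [folklore] -/
private theorem tendsto_zero_of_abs_le_cf {x y : ℕ → ℝ} (hxy : ∀ n, |x n| ≤ y n) (hy : Tendsto y atTop (𝓝 0)) :
    Tendsto x atTop (𝓝 0) :=
  squeeze_zero_norm (fun n => by simpa [Real.norm_eq_abs] using hxy n) hy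

omit [Fintype d] [DecidableEq d] in
/-- **Exponential decay from the two-point inequality** `g(s₂)(1 + c(s₂ − s₁)) ≤ g(s₁)`
(`0 ≤ s₁ ≤ s₂ ≤ t`): `g(t) ≤ g(0) e^{−ct}` — partition `[0,t]` into `n` pieces,
`g(t) ≤ g(0)(1 + ct/n)^{−n}`, and let `n → ∞`. [folklore] -/
private theorem le_mul_exp_neg_of_two_point_cf {g : ℝ → ℝ} {c t : ℝ} (hc : 0 ≤ c) (ht : 0 ≤ t)
    (hg : ∀ s₁ s₂, 0 ≤ s₁ → s₁ ≤ s₂ → s₂ ≤ t → g s₂ * (1 + c * (s₂ - s₁)) ≤ g s₁) :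
    g t ≤ g 0 * Real.exp (-(c * t)) := by
  -- step bound along the uniform partition
  have hstep : ∀ n : ℕ, 0 < n → ∀ j : ℕ, j ≤ n → g (j * (t / n)) ≤ g 0 / (1 + c * (t / n)) ^ j := by
    intro n hn j
    induction j with
    | zero => intro _; simp
    | succ j ih =>
      intro hj
      have hq : 0 < 1 + c * (t / n) := by positivity
      have h1 := ih (Nat.le_of_succ_le hj)
      have hn' : (0 : ℝ) < n := by exact_mod_cast hn
      have hle1 : (j : ℝ) * (t / n) ≤ ((j + 1 : ℕ) : ℝ) * (t / n) :=
        mul_le_mul_of_nonneg_right (by exact_mod_cast Nat.le_succ j) (by positivity)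
      have hle2 : ((j + 1 : ℕ) : ℝ) * (t / n) ≤ t := by
        have hjn : ((j + 1 : ℕ) : ℝ) ≤ n := by exact_mod_cast hj
        calc ((j + 1 : ℕ) : ℝ) * (t / n) ≤ (n : ℝ) * (t / n) := mul_le_mul_of_nonneg_right hjn (by positivity)
          _ = t := by field_simp
      have h2 := hg (j * (t / n)) ((j + 1 : ℕ) * (t / n)) (by positivity) hle1 hle2
      have e : ((j + 1 : ℕ) : ℝ) * (t / n) - j * (t / n) = t / n := by push_cast; ring
      rw [e] at h2
      rw [pow_succ, ← div_div, le_div_iff₀ hq]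
      exact h2.trans h1
  -- `g t ≤ g 0 / (1 + (c t)/n) ^ n` for `n ≥ 1`
  have hbound : ∀ᶠ n : ℕ in atTop, g t ≤ g 0 / (1 + c * t / n) ^ n := by
    filter_upwards [eventually_gt_atTop 0] with n hn
    have h := hstep n hn n le_rfl
    have hn' : (n : ℝ) ≠ 0 := by exact_mod_cast hn.ne'
    have e1 : (n : ℝ) * (t / n) = t := by field_simp
    have e2 : c * (t / n) = c * t / n := by ring
    rwa [e1, e2] at h
  -- pass to the limit
  have hlim : Tendsto (fun n : ℕ => g 0 / (1 + c * t / n) ^ n) atTop (𝓝 (g 0 / Real.exp (c * t))) :=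
    tendsto_const_nhds.div (Real.tendsto_one_add_div_pow_exp (c * t)) (Real.exp_pos _).ne'
  have h := ge_of_tendsto hlim hbound
  rwa [Real.exp_neg, ← div_eq_mul_inv]

end RealLemmas

namespace IsWeakTensorPassiveVectorDistortedOn

variable {T : ℝ} {𝔸 : Visc4 d} {b w : ℝ → UnitAddTorus d → EuclideanSpace ℝ d} {G₀ : Matrix d d ℝ}
  {w₀ : UnitAddTorus d → EuclideanSpace ℝ d}

/-! ## The limit of the integrated truncated twisted symbol forms (energy equality, constant frame) -/

/-- **Energy equality with the twisted tensor dissipation, limit form (constant non-degenerate frame).**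
For `A = 0`, `NearIso 𝔸 lo hi` with `0 < lo`, a frame with `c|k|² ≤ |G₀ᵀk|²` (`0 < c`),
`stLift b ∈ L^∞((0,T) × T^d)` and a datum `w₀ ∈ L²` with `∇·(G₀ w₀) = 0` weakly: for a.e. `t ∈ (0,T)` the
integrated truncated symbol forms converge,
`∫_{(0,t]} 4π² ∑_{|k|≤N} Re ⟪ŵ(s)(k), T_{𝔸^{G₀}}(k) ŵ(s)(k)⟫ ds → (‖w₀‖²_{L²} − ‖w(t)‖²_{L²})/2` as `N → ∞`
(the truncated energy identity, the transport remainder `→ 0` in `L¹(0,T)` by the Parseval tails and the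
finite dissipation, Parseval for the energies; Temam 1984, Ch. III Lemma 1.2 in Galerkin form).
[cite: Temam1984, Ch. III §1 Lemma 1.2] [cite: RobinsonRodrigoSadowski2016, §4.2 (4.20)]
[cite: ArmstrongVicol2025, §4.1 (PDF p. 34)] -/
theorem ae_tendsto_setIntegral_symbForm_constFrame (h : IsWeakTensorPassiveVectorDistortedOn 0 T 𝔸 b (fun _ _ => G₀) w₀ w)
    {lo hi : ℝ} (h𝔸 : NearIso 𝔸 lo hi) (hlo : 0 < lo)
    {c : ℝ} (hc : 0 < c) (hG : ∀ k : d → ℤ, c * FunctionSpaces.Torus.freqNormSq k ≤ ∑ a, twistFreq G₀ k a ^ 2)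
    (hw₀ : MemLp w₀ 2 volume) (hdiv₀ : FunctionSpaces.Torus.IsWeaklyDivFree (distort (fun _ => G₀) w₀))
    (hb : MemLp (FunctionSpaces.Torus.stLift b) ∞ (volume.restrict (Ioo 0 T ×ˢ univ))) :
    ∀ᵐ t ∂(volume.restrict (Ioo 0 T)),
      Tendsto (fun N : ℕ => ∫ s in Ioc 0 t, 4 * Real.pi ^ 2 * ∑ k ∈ FunctionSpaces.Torus.freqBall N,
        (⟪mFourierCoeff (FunctionSpaces.EuclideanSpace.complexify ∘ w s) k,
          symbT (Visc4.conj G₀ 𝔸) k (mFourierCoeff (FunctionSpaces.EuclideanSpace.complexify ∘ w s) k)⟫_ℂ).re) atTop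
        (𝓝 (((∫ x, ‖w₀ x‖ ^ 2) - ∫ x, ‖w t x‖ ^ 2) / 2)) := by
  classical
  have hloc : 0 < lo * c := mul_pos hlo hc
  obtain ⟨M, hM, hbM⟩ := ae_ae_norm_le_of_memLp_top_stLift hb
  -- ### notation
  set P : ℕ → (UnitAddTorus d → EuclideanSpace ℝ d) → UnitAddTorus d → EuclideanSpace ℝ d :=
    fun N v => FunctionSpaces.Torus.fourierTruncate N v with hP
  set X : (d → ℤ) → ℝ → EuclideanSpace ℂ d := fun k s =>
    mFourierCoeff (FunctionSpaces.EuclideanSpace.complexify ∘ w s) k with hX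
  set X₀ : (d → ℤ) → EuclideanSpace ℂ d := fun k => mFourierCoeff (FunctionSpaces.EuclideanSpace.complexify ∘ w₀) k with hX₀
  set Q : ℕ → ℝ → ℝ := fun N s => 4 * Real.pi ^ 2 * ∑ k ∈ FunctionSpaces.Torus.freqBall N,
    (⟪X k s, symbT (Visc4.conj G₀ 𝔸) k (X k s)⟫_ℂ).re with hQ
  set F : ℕ → ℝ → ℝ := fun N s =>
    (∫ x, ⟪w s x, FunctionSpaces.Torus.convect (b s) (P N (w s)) x⟫_ℝ) +
      (0 : ℝ) * ∫ x, ⟪b s x, FunctionSpaces.Torus.convect (w s) (P N (w s)) x⟫_ℝ with hF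
  set D : ℕ → ℝ → ℝ := fun N s => (FunctionSpaces.Torus.eGradNormSq (P N (w s))).toReal with hD
  set R : ℕ → ℝ → ℝ := fun N s =>
    ∫ x, ⟪w s x - P N (w s) x, FunctionSpaces.Torus.convect (b s) (P N (w s)) x⟫_ℝ with hR
  set tail : ℕ → ℝ → ℝ := fun N s => ∫ x, ‖w s x - P N (w s) x‖ ^ 2 with htail
  set C : ℝ := Fintype.card d * M with hC
  have hC0 : 0 ≤ C := by positivity
  set g : ℝ → ℝ≥0∞ := fun s => FunctionSpaces.Torus.eGradNormSq (w s) with hg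
  -- ### finite dissipation on `(0,T)`
  have hDT : eVectorDissipation (lo * c) w 0 T < ⊤ := h.eVectorDissipation_lt_top_constFrame h𝔸 hlo hc hG hw₀ hdiv₀ hb
  have hfin : ∫⁻ s in Ioo 0 T, g s < ⊤ := by
    unfold eVectorDissipation at hDT
    rcases ENNReal.mul_lt_top_iff.1 hDT with h1 | h1 | h1
    · exact h1.2
    · exact absurd (ENNReal.ofReal_eq_zero.1 h1) (not_le.2 hloc)
    · rw [h1]; exact ENNReal.zero_lt_top
  -- ### the truncated identity for a.e. `t` and all `N`
  have hId : ∀ᵐ t ∂(volume.restrict (Ioo 0 T)), ∀ N,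
      (∑ k ∈ FunctionSpaces.Torus.freqBall N, ‖X k t‖ ^ 2) + 2 * ∫ s in Ioc 0 t, Q N s =
        (∑ k ∈ FunctionSpaces.Torus.freqBall N, ‖X₀ k‖ ^ 2) + 2 * ∫ s in Ioc 0 t, F N s :=
    h.ae_sum_sq_norm_mFourierCoeff_eq_constFrame hw₀ hdiv₀
  -- ### integrability on `(0,T)`
  have hFint : ∀ N, IntegrableOn (F N) (Ioo 0 T) := fun N => h.integrableOn_galerkinFlux N
  have hDint : ∀ N, IntegrableOn (D N) (Ioo 0 T) ∧ ∫ s in Ioo 0 T, D N s ≤ (∫⁻ s in Ioo 0 T, g s).toReal :=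
    fun N => h.integrableOn_toReal_eGradNormSq_fourierTruncate hfin N
  obtain ⟨htailint, -, -⟩ := h.galerkin_tail
  -- ### the flux is a remainder, a.e. in `s`
  have hFR : ∀ N, ∀ᵐ s ∂(volume.restrict (Ioo 0 T)),
      F N s = R N s ∧ |R N s| ≤ C * Real.sqrt (tail N s) * Real.sqrt (D N s) :=
    fun N => h.ae_galerkinFlux_eq_remainder hM hbM N
  -- ### the remainder integral is small, uniformly in `t`
  have htail_nn : ∀ N s, 0 ≤ tail N s := fun N s => integral_nonneg fun x => sq_nonneg _
  have hD_nn : ∀ N s, 0 ≤ D N s := fun N s => ENNReal.toReal_nonneg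
  set Y : ℕ → ℝ := fun N =>
    C * (Real.sqrt (∫ s in Ioo 0 T, tail N s) * Real.sqrt ((∫⁻ s in Ioo 0 T, g s).toReal)) with hYdef
  have hY : ∀ N, ∫ s in Ioo 0 T, |F N s| ≤ Y N := by
    intro N
    have hm : AEStronglyMeasurable (fun s => Real.sqrt (tail N s) * Real.sqrt (D N s)) (volume.restrict (Ioo 0 T)) :=
      (Real.continuous_sqrt.comp_aestronglyMeasurable (htailint N).aestronglyMeasurable).mul
        (Real.continuous_sqrt.comp_aestronglyMeasurable (hDint N).1.aestronglyMeasurable)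
    have hst : IntegrableOn (fun s => Real.sqrt (tail N s) * Real.sqrt (D N s)) (Ioo 0 T) := by
      refine Integrable.mono' (((htailint N).add (hDint N).1).div_const 2) hm (ae_of_all _ fun s => ?_)
      show ‖Real.sqrt (tail N s) * Real.sqrt (D N s)‖ ≤ (tail N s + D N s) / 2
      rw [Real.norm_eq_abs, abs_of_nonneg (mul_nonneg (Real.sqrt_nonneg _) (Real.sqrt_nonneg _))]
      nlinarith [Real.sq_sqrt (htail_nn N s), Real.sq_sqrt (hD_nn N s),
        sq_nonneg (Real.sqrt (tail N s) - Real.sqrt (D N s))]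
    calc ∫ s in Ioo 0 T, |F N s|
        ≤ ∫ s in Ioo 0 T, C * (Real.sqrt (tail N s) * Real.sqrt (D N s)) := by
          refine integral_mono_ae (hFint N).abs (hst.const_mul C) ?_
          filter_upwards [hFR N] with s hs
          rw [hs.1]
          calc |R N s| ≤ C * Real.sqrt (tail N s) * Real.sqrt (D N s) := hs.2
            _ = C * (Real.sqrt (tail N s) * Real.sqrt (D N s)) := by ring
      _ = C * ∫ s in Ioo 0 T, Real.sqrt (tail N s) * Real.sqrt (D N s) := integral_const_mul _ _
      _ ≤ C * (Real.sqrt (∫ s in Ioo 0 T, tail N s) * Real.sqrt (∫ s in Ioo 0 T, D N s)) :=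
          mul_le_mul_of_nonneg_left (integral_sqrt_mul_sqrt_le_cf (htailint N) (hDint N).1
            (ae_of_all _ fun s => htail_nn N s) (ae_of_all _ fun s => hD_nn N s)) hC0
      _ ≤ Y N := by
          rw [hYdef]
          exact mul_le_mul_of_nonneg_left (mul_le_mul_of_nonneg_left (Real.sqrt_le_sqrt (hDint N).2)
            (Real.sqrt_nonneg _)) hC0
  have hY0 : Tendsto Y atTop (𝓝 0) := by
    have h1 := h.tendsto_integral_galerkin_tail
    have h2 : Tendsto (fun N => Real.sqrt (∫ s in Ioo 0 T, tail N s)) atTop (𝓝 0) := by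
      have := (Real.continuous_sqrt.tendsto 0).comp h1
      rwa [Real.sqrt_zero] at this
    have h3 := (h2.mul_const (Real.sqrt ((∫⁻ s in Ioo 0 T, g s).toReal))).const_mul C
    rw [zero_mul, mul_zero] at h3
    exact h3
  -- ### conclude at a.e. `t`
  filter_upwards [hId, h.ae_memLp_two, ae_restrict_mem measurableSet_Ioo] with t ht ht2 htI
  have hsub : Ioc 0 t ⊆ Ioo 0 T := Ioc_subset_Ioo_right htI.2
  have hXle : ∀ N, |∫ s in Ioc 0 t, F N s| ≤ Y N := by
    intro N
    calc |∫ s in Ioc 0 t, F N s| ≤ ∫ s in Ioc 0 t, |F N s| := abs_integral_le_integral_abs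
      _ ≤ ∫ s in Ioo 0 T, |F N s| :=
          setIntegral_mono_set (hFint N).abs (ae_of_all _ fun s => abs_nonneg _) hsub.eventuallyLE
      _ ≤ Y N := hY N
  have hX0 : Tendsto (fun N => ∫ s in Ioc 0 t, F N s) atTop (𝓝 0) := tendsto_zero_of_abs_le_cf hXle hY0
  -- energies: Parseval along the frequency balls
  have hE : Tendsto (fun N => ∑ k ∈ FunctionSpaces.Torus.freqBall N, ‖X k t‖ ^ 2) atTop (𝓝 (∫ x, ‖w t x‖ ^ 2)) :=
    (FunctionSpaces.Torus.hasSum_sq_norm_mFourierCoeff_complexify ht2).comp FunctionSpaces.Torus.tendsto_freqBall_atTop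
  have hE0 : Tendsto (fun N => ∑ k ∈ FunctionSpaces.Torus.freqBall N, ‖X₀ k‖ ^ 2) atTop (𝓝 (∫ x, ‖w₀ x‖ ^ 2)) :=
    (FunctionSpaces.Torus.hasSum_sq_norm_mFourierCoeff_complexify hw₀).comp FunctionSpaces.Torus.tendsto_freqBall_atTop
  -- solve the identity for `∫ Q_N`
  have hsolve : ∀ N, ∫ s in Ioc 0 t, Q N s =
      ((∑ k ∈ FunctionSpaces.Torus.freqBall N, ‖X₀ k‖ ^ 2) + 2 * (∫ s in Ioc 0 t, F N s) -
        ∑ k ∈ FunctionSpaces.Torus.freqBall N, ‖X k t‖ ^ 2) / 2 := by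
    intro N
    have := ht N
    linarith
  have hlim := ((hE0.add (hX0.const_mul 2)).sub hE).div_const 2
  rw [mul_zero, add_zero] at hlim
  exact hlim.congr fun N => (hsolve N).symm

/-! ## The energy inequality with the twisted coercivity constant -/

/-- **Energy inequality for constant-frame distorted weak solutions with a coercive tensor and bounded
carrier.** For `A = 0`, `NearIso 𝔸 lo hi` with `0 < lo`, a frame with `c|k|² ≤ |G₀ᵀk|²` (`0 < c`),
`stLift b ∈ L^∞((0,T) × T^d)` and an `L²` datum with `∇·(G₀ w₀) = 0` weakly, EVERY weak solution satisfies,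
for a.e. `t ∈ (0,T)`, `‖w(t)‖²_{L²} + 2 (lo c) ∫₀ᵗ ‖∇w‖²_{L²} ≤ ‖w₀‖²_{L²}` (in `[0,∞]`,
`Torus.eVectorDissipation (lo * c)`): the twisted energy equality `ae_tendsto_setIntegral_symbForm_constFrame`
and the coercivity of the truncated twisted symbol form against the truncated dissipation, whose integrals
increase to `∫₀ᵗ‖∇w‖²`. [cite: Temam1984, Ch. III §1 Lemma 1.2] [cite: Giaquinta1983MultipleIntegrals, Ch. III §2 eq. (2.2)]
[cite: ArmstrongVicol2025, §4.1 (PDF p. 34)] -/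
theorem ae_energy_ineq_constFrame (h : IsWeakTensorPassiveVectorDistortedOn 0 T 𝔸 b (fun _ _ => G₀) w₀ w)
    {lo hi : ℝ} (h𝔸 : NearIso 𝔸 lo hi) (hlo : 0 < lo)
    {c : ℝ} (hc : 0 < c) (hG : ∀ k : d → ℤ, c * FunctionSpaces.Torus.freqNormSq k ≤ ∑ a, twistFreq G₀ k a ^ 2)
    (hw₀ : MemLp w₀ 2 volume) (hdiv₀ : FunctionSpaces.Torus.IsWeaklyDivFree (distort (fun _ => G₀) w₀))
    (hb : MemLp (FunctionSpaces.Torus.stLift b) ∞ (volume.restrict (Ioo 0 T ×ˢ univ))) :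
    ∀ᵐ t ∂(volume.restrict (Ioo 0 T)),
      ENNReal.ofReal (∫ x, ‖w t x‖ ^ 2) + 2 * eVectorDissipation (lo * c) w 0 t ≤ ENNReal.ofReal (∫ x, ‖w₀ x‖ ^ 2) := by
  classical
  have hloc : 0 < lo * c := mul_pos hlo hc
  set P : ℕ → (UnitAddTorus d → EuclideanSpace ℝ d) → UnitAddTorus d → EuclideanSpace ℝ d :=
    fun N v => FunctionSpaces.Torus.fourierTruncate N v with hP
  set Q : ℕ → ℝ → ℝ := fun N s => 4 * Real.pi ^ 2 * ∑ k ∈ FunctionSpaces.Torus.freqBall N,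
    (⟪mFourierCoeff (FunctionSpaces.EuclideanSpace.complexify ∘ w s) k,
      symbT (Visc4.conj G₀ 𝔸) k (mFourierCoeff (FunctionSpaces.EuclideanSpace.complexify ∘ w s) k)⟫_ℂ).re with hQ
  set D : ℕ → ℝ → ℝ := fun N s => (FunctionSpaces.Torus.eGradNormSq (P N (w s))).toReal with hD
  set g : ℝ → ℝ≥0∞ := fun s => FunctionSpaces.Torus.eGradNormSq (w s) with hg
  have hDT : eVectorDissipation (lo * c) w 0 T < ⊤ := h.eVectorDissipation_lt_top_constFrame h𝔸 hlo hc hG hw₀ hdiv₀ hb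
  have hfin : ∫⁻ s in Ioo 0 T, g s < ⊤ := by
    unfold eVectorDissipation at hDT
    rcases ENNReal.mul_lt_top_iff.1 hDT with h1 | h1 | h1
    · exact h1.2
    · exact absurd (ENNReal.ofReal_eq_zero.1 h1) (not_le.2 hloc)
    · rw [h1]; exact ENNReal.zero_lt_top
  have hDint : ∀ N, IntegrableOn (D N) (Ioo 0 T) ∧ ∫ s in Ioo 0 T, D N s ≤ (∫⁻ s in Ioo 0 T, g s).toReal :=
    fun N => h.integrableOn_toReal_eGradNormSq_fourierTruncate hfin N
  have hQint : ∀ N, IntegrableOn (Q N) (Ioo 0 T) := fun N => h.integrableOn_symbForm (Visc4.conj G₀ 𝔸) N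
  have hcoer : ∀ᵐ s ∂(volume.restrict (Ioo 0 T)), ∀ N : ℕ, lo * c * D N s ≤ Q N s :=
    h.ae_lo_mul_le_symbForm_constFrame h𝔸 hlo.le hG
  filter_upwards [h.ae_tendsto_setIntegral_symbForm_constFrame h𝔸 hlo hc hG hw₀ hdiv₀ hb, ae_restrict_mem measurableSet_Ioo]
    with t ht htI
  have hsub : Ioc 0 t ⊆ Ioo 0 T := Ioc_subset_Ioo_right htI.2
  -- the truncated dissipation on `(0,t]`: monotone convergence
  have hDlim : Tendsto (fun N => ∫ s in Ioc 0 t, D N s) atTop (𝓝 ((∫⁻ s in Ioo 0 t, g s).toReal)) := by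
    set μt : Measure ℝ := volume.restrict (Ioo 0 t) with hμt
    have hsub' : Ioo 0 t ⊆ Ioo 0 T := Ioo_subset_Ioo le_rfl htI.2.le
    have hle : μt ≤ volume.restrict (Ioo 0 T) := Measure.restrict_mono hsub' le_rfl
    have hG_m : ∀ N, AEMeasurable (fun s => FunctionSpaces.Torus.eGradNormSq (P N (w s))) μt := fun N =>
      (h.aemeasurable_eGradNormSq_fourierTruncate N).mono_measure hle
    have hfin_t : ∫⁻ s in Ioo 0 t, g s ≠ ⊤ := ((lintegral_mono' hle le_rfl).trans_lt hfin).ne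
    have hgood : ∀ᵐ s ∂μt, Integrable (w s) volume :=
      ae_restrict_of_ae_restrict_of_subset hsub' (h.ae_integrable_slice.mono fun s hs => hs.1)
    have hL : Tendsto (fun N => ∫⁻ s in Ioo 0 t, FunctionSpaces.Torus.eGradNormSq (P N (w s))) atTop
        (𝓝 (∫⁻ s in Ioo 0 t, g s)) := by
      refine lintegral_tendsto_of_tendsto_of_monotone hG_m ?_ ?_
      · filter_upwards [hgood] with s hs
        intro N N' hNN'
        show FunctionSpaces.Torus.eGradNormSq (P N (w s)) ≤ FunctionSpaces.Torus.eGradNormSq (P N' (w s))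
        rw [hP, Torus.eGradNormSq_fourierTruncate_eq_sum hs N, Torus.eGradNormSq_fourierTruncate_eq_sum hs N']
        exact mul_le_mul' le_rfl (Finset.sum_le_sum_of_subset (FunctionSpaces.Torus.freqBall_mono hNN'))
      · filter_upwards [hgood] with s hs
        have hsum := (ENNReal.summable (f := fun k : d → ℤ =>
          ENNReal.ofReal (FunctionSpaces.Torus.freqNormSq k) *
            ‖UnitAddTorus.mFourierCoeff (FunctionSpaces.EuclideanSpace.complexify ∘ w s) k‖ₑ ^ 2)).hasSum
        have h' := ENNReal.Tendsto.const_mul (hsum.comp FunctionSpaces.Torus.tendsto_freqBall_atTop)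
          (Or.inr (ENNReal.ofReal_ne_top (r := 4 * Real.pi ^ 2)))
        rw [← FunctionSpaces.Torus.eGradNormSq_eq_tsum] at h'
        exact h'.congr fun N => (Torus.eGradNormSq_fourierTruncate_eq_sum hs N).symm
    have hL' := (ENNReal.tendsto_toReal hfin_t).comp hL
    refine hL'.congr fun N => ?_
    have hfinN : ∀ᵐ s ∂μt, FunctionSpaces.Torus.eGradNormSq (P N (w s)) < ⊤ := ae_of_all _ fun s =>
      FunctionSpaces.Torus.eGradNormSq_lt_top (FunctionSpaces.Torus.isSmooth_fourierTruncate N _)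
    rw [Function.comp_apply, ← integral_toReal (hG_m N) hfinN, hμt, setIntegral_congr_set Ioo_ae_eq_Ioc]
  -- `(lo c) ∫ D_N ≤ ∫ Q_N`
  have hle : ∀ N, lo * c * ∫ s in Ioc 0 t, D N s ≤ ∫ s in Ioc 0 t, Q N s := by
    intro N
    rw [← integral_const_mul]
    exact integral_mono_ae (((hDint N).1.mono_set hsub).const_mul (lo * c)) ((hQint N).mono_set hsub)
      (ae_restrict_of_ae_restrict_of_subset hsub (hcoer.mono fun s hs => hs N))
  have hlimle : lo * c * (∫⁻ s in Ioo 0 t, g s).toReal ≤ ((∫ x, ‖w₀ x‖ ^ 2) - ∫ x, ‖w t x‖ ^ 2) / 2 :=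
    le_of_tendsto_of_tendsto' (hDlim.const_mul (lo * c)) ht hle
  -- rewrite in `ℝ≥0∞`
  have hfin_t : ∫⁻ s in Ioo 0 t, g s ≠ ⊤ :=
    ((lintegral_mono' (Measure.restrict_mono (Ioo_subset_Ioo le_rfl htI.2.le) le_rfl) le_rfl).trans_lt hfin).ne
  have hEt : 0 ≤ ∫ x, ‖w t x‖ ^ 2 := integral_nonneg fun x => sq_nonneg _
  have hreal : (∫ x, ‖w t x‖ ^ 2) + 2 * (lo * c * (∫⁻ s in Ioo 0 t, g s).toReal) ≤ ∫ x, ‖w₀ x‖ ^ 2 := by linarith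
  unfold eVectorDissipation
  calc ENNReal.ofReal (∫ x, ‖w t x‖ ^ 2) + 2 * (ENNReal.ofReal (lo * c) * ∫⁻ s in Ioo 0 t, g s)
      = ENNReal.ofReal ((∫ x, ‖w t x‖ ^ 2) + 2 * (lo * c * (∫⁻ s in Ioo 0 t, g s).toReal)) := by
        rw [ENNReal.ofReal_add hEt (by positivity), ENNReal.ofReal_mul (by norm_num : (0:ℝ) ≤ 2), ENNReal.ofReal_ofNat,
          ENNReal.ofReal_mul hloc.le, ENNReal.ofReal_toReal hfin_t]
    _ ≤ ENNReal.ofReal (∫ x, ‖w₀ x‖ ^ 2) := ENNReal.ofReal_le_ofReal hreal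

/-! ## Exponential decay for mean-zero data -/

/-- **Exponential energy decay of EVERY constant-frame distorted weak solution with a coercive viscosity
tensor, non-degenerate frame, bounded carrier and mean-zero datum.** For `A = 0`, `NearIso 𝔸 lo hi` with
`0 < lo`, `c|k|² ≤ |G₀ᵀk|²` (`0 < c`), `stLift b ∈ L^∞((0,T) × T^d)` and a datum `w₀ ∈ L²` with
`∇·(G₀ w₀) = 0` weakly and `∫ w₀ = 0`: for a.e. `t ∈ (0,T)`, `‖w(t)‖²_{L²} ≤ exp(−8π² (lo c) t) ‖w₀‖²_{L²}`.
Proof: the zero mode is conserved (`ŵ(s)(0) = ŵ₀(0) = 0`), so the truncated twisted symbol form dominates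
`4π² (lo c) ∑_{|k|≤N} ‖ŵ(s)(k)‖²` (`|G₀ᵀk|² ≥ c|k|² ≥ c`); with `Q = sup_N Q_N` the energy equality reads
`‖w(t)‖² = E(t) := ‖w₀‖² − 2∫₀ᵗ Q` a.e., `E` is nonincreasing and `E(t₂)(1 + 8π² (lo c)(t₂ − t₁)) ≤ E(t₁)`,
whence `E(t) ≤ E(0)(1 + 8π²(lo c) t/n)^{-n} → ‖w₀‖² e^{−8π² (lo c) t}`.
[cite: Temam1984, Ch. III §1 Lemma 1.2] [cite: Giaquinta1983MultipleIntegrals, Ch. III §2 eq. (2.2)]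
[cite: ArmstrongVicol2025, §4.1 (PDF p. 34)] [cite: Frisch1995Turbulence, §9.6.3 eq. (9.57) p. 233] -/
theorem ae_integral_norm_sq_le_exp_constFrame (h : IsWeakTensorPassiveVectorDistortedOn 0 T 𝔸 b (fun _ _ => G₀) w₀ w)
    {lo hi : ℝ} (h𝔸 : NearIso 𝔸 lo hi) (hlo : 0 < lo)
    {c : ℝ} (hc : 0 < c) (hG : ∀ k : d → ℤ, c * FunctionSpaces.Torus.freqNormSq k ≤ ∑ a, twistFreq G₀ k a ^ 2)
    (hw₀ : MemLp w₀ 2 volume) (hdiv₀ : FunctionSpaces.Torus.IsWeaklyDivFree (distort (fun _ => G₀) w₀))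
    (hmean₀ : FunctionSpaces.Torus.HasZeroMean w₀)
    (hb : MemLp (FunctionSpaces.Torus.stLift b) ∞ (volume.restrict (Ioo 0 T ×ˢ univ))) :
    ∀ᵐ t ∂(volume.restrict (Ioo 0 T)),
      ∫ x, ‖w t x‖ ^ 2 ≤ Real.exp (-(8 * Real.pi ^ 2 * (lo * c) * t)) * ∫ x, ‖w₀ x‖ ^ 2 := by
  classical
  have hloc : 0 < lo * c := mul_pos hlo hc
  -- ### notation
  set X : (d → ℤ) → ℝ → EuclideanSpace ℂ d := fun k s =>
    mFourierCoeff (FunctionSpaces.EuclideanSpace.complexify ∘ w s) k with hX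
  set Q : ℕ → ℝ → ℝ := fun N s => 4 * Real.pi ^ 2 * ∑ k ∈ FunctionSpaces.Torus.freqBall N,
    (⟪X k s, symbT (Visc4.conj G₀ 𝔸) k (X k s)⟫_ℂ).re with hQ
  set E : ℝ → ℝ := fun s => ∫ x, ‖w s x‖ ^ 2 with hE
  set E₀ : ℝ := ∫ x, ‖w₀ x‖ ^ 2 with hE₀
  set κ : ℝ := 8 * Real.pi ^ 2 * (lo * c) with hκ
  have hκ0 : 0 ≤ κ := by positivity
  -- the supremum of the truncated symbol forms, in `ℝ≥0∞`
  set Qs : ℝ → ℝ≥0∞ := fun s => ⨆ N : ℕ, ENNReal.ofReal (Q N s) with hQs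
  -- ### a.e.-in-`s` facts
  have hQint : ∀ N, IntegrableOn (Q N) (Ioo 0 T) := fun N => h.integrableOn_symbForm (Visc4.conj G₀ 𝔸) N
  have hmono : ∀ᵐ s ∂(volume.restrict (Ioo 0 T)), Monotone fun N : ℕ => Q N s := h.ae_symbForm_mono_constFrame h𝔸 hlo.le
  have hQnn : ∀ᵐ s ∂(volume.restrict (Ioo 0 T)), ∀ N, 0 ≤ Q N s := by
    filter_upwards [h.ae_re_inner_symbT_nonneg_constFrame h𝔸 hlo.le] with s hs
    intro N
    exact mul_nonneg (by positivity) (Finset.sum_nonneg fun k _ => hs k)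
  -- the zero mode vanishes for a.e. `s`
  have hzero : ∀ᵐ s ∂(volume.restrict (Ioo 0 T)), X 0 s = 0 := by
    filter_upwards [h.ae_mFourierCoeff_zero_eq_constFrame (hw₀.integrable one_le_two)] with s hs
    rw [hX]
    simp only
    rw [hs]
    exact FunctionSpaces.Torus.mFourierCoeff_complexify_zero_of_hasZeroMean (hw₀.integrable one_le_two) hmean₀
  -- the energy lower bound of the symbol form: `4π² (lo c) E_N(s) ≤ Q_N(s)`, hence `ofReal (κ/2 · E(s)) ≤ Qs s`
  have hlow : ∀ᵐ s ∂(volume.restrict (Ioo 0 T)), ENNReal.ofReal (κ / 2 * E s) ≤ Qs s := by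
    filter_upwards [h.ae_lo_mul_sum_sq_norm_le_symbForm_constFrame h𝔸 hlo.le hc.le hG, hzero, h.ae_memLp_two] with s hs hz hs2
    have hEN : Tendsto (fun N => κ / 2 * ∑ k ∈ FunctionSpaces.Torus.freqBall N, ‖X k s‖ ^ 2) atTop
        (𝓝 (κ / 2 * E s)) :=
      ((FunctionSpaces.Torus.hasSum_sq_norm_mFourierCoeff_complexify hs2).comp
        FunctionSpaces.Torus.tendsto_freqBall_atTop).const_mul _
    have hEN' := ENNReal.tendsto_ofReal hEN
    refine le_of_tendsto' hEN' fun N => ?_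
    have h1 : κ / 2 * ∑ k ∈ FunctionSpaces.Torus.freqBall N, ‖X k s‖ ^ 2 ≤ Q N s := by
      have := hs hz N
      rw [hκ, hQ]
      simp only
      linarith
    exact (ENNReal.ofReal_le_ofReal h1).trans (le_iSup (fun N : ℕ => ENNReal.ofReal (Q N s)) N)
  -- measurability of `Qs`
  have hQm : ∀ N, AEMeasurable (fun s => ENNReal.ofReal (Q N s)) (volume.restrict (Ioo 0 T)) := fun N =>
    (hQint N).aestronglyMeasurable.aemeasurable.ennreal_ofReal
  -- ### the energy identity with `Qs`, at a.e. `t`: `2 (∫⁻_{(0,t]} Qs).toReal = E₀ - E t`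
  have hEq : ∀ᵐ t ∂(volume.restrict (Ioo 0 T)), ∫⁻ s in Ioc 0 t, Qs s = ENNReal.ofReal ((E₀ - E t) / 2) := by
    filter_upwards [h.ae_tendsto_setIntegral_symbForm_constFrame h𝔸 hlo hc hG hw₀ hdiv₀ hb, ae_restrict_mem measurableSet_Ioo]
      with t ht htI
    have hsub : Ioc 0 t ⊆ Ioo 0 T := Ioc_subset_Ioo_right htI.2
    -- monotone convergence on `(0,t]`
    have hmc : ∫⁻ s in Ioc 0 t, Qs s = ⨆ N : ℕ, ∫⁻ s in Ioc 0 t, ENNReal.ofReal (Q N s) := by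
      rw [hQs]
      exact lintegral_iSup' (fun N => (hQm N).mono_measure (Measure.restrict_mono hsub le_rfl))
        (ae_restrict_of_ae_restrict_of_subset hsub (hmono.mono fun s hs N N' hNN' => ENNReal.ofReal_le_ofReal (hs hNN')))
    have heq : ∀ N, ∫⁻ s in Ioc 0 t, ENNReal.ofReal (Q N s) = ENNReal.ofReal (∫ s in Ioc 0 t, Q N s) := fun N =>
      (ofReal_integral_eq_lintegral_ofReal ((hQint N).mono_set hsub)
        (ae_restrict_of_ae_restrict_of_subset hsub (hQnn.mono fun s hs => hs N))).symm
    simp_rw [heq] at hmc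
    rw [hmc]
    -- the `ofReal` of a convergent monotone sequence
    have hmono' : Monotone fun N : ℕ => ENNReal.ofReal (∫ s in Ioc 0 t, Q N s) := by
      intro N N' hNN'
      refine ENNReal.ofReal_le_ofReal (integral_mono_ae ((hQint N).mono_set hsub) ((hQint N').mono_set hsub) ?_)
      exact ae_restrict_of_ae_restrict_of_subset hsub (hmono.mono fun s hs => hs hNN')
    have h1 : Tendsto (fun N : ℕ => ENNReal.ofReal (∫ s in Ioc 0 t, Q N s)) atTop
        (𝓝 (⨆ N : ℕ, ENNReal.ofReal (∫ s in Ioc 0 t, Q N s))) := tendsto_atTop_iSup hmono'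
    have h2 := ENNReal.tendsto_ofReal ht
    exact tendsto_nhds_unique h1 h2
  have hEq' : ∀ᵐ t ∂(volume : Measure ℝ), t ∈ Ioo 0 T → ∫⁻ s in Ioc 0 t, Qs s = ENNReal.ofReal ((E₀ - E t) / 2) :=
    (ae_restrict_iff' measurableSet_Ioo).1 hEq
  have hlow' : ∀ᵐ s ∂(volume : Measure ℝ), s ∈ Ioo 0 T → ENNReal.ofReal (κ / 2 * E s) ≤ Qs s :=
    (ae_restrict_iff' measurableSet_Ioo).1 hlow
  -- ### the energy is below the initial energy, and the representative agrees with it, a.e.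
  have hEle' : ∀ᵐ s ∂(volume : Measure ℝ), s ∈ Ioo 0 T → E s ≤ E₀ := by
    refine (ae_restrict_iff' measurableSet_Ioo).1 ?_
    filter_upwards [h.ae_energy_ineq_constFrame h𝔸 hlo hc hG hw₀ hdiv₀ hb] with s hs
    have h1 : ENNReal.ofReal (E s) ≤ ENNReal.ofReal E₀ := le_trans le_self_add hs
    exact (ENNReal.ofReal_le_ofReal_iff (integral_nonneg fun x => sq_nonneg _)).1 h1
  -- ### the continuous representative of the energy
  set Et : ℝ → ℝ := fun t => E₀ - 2 * (∫⁻ s in Ioc 0 t, Qs s).toReal with hEt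
  have hEint : IntegrableOn E (Ioo 0 T) := h.integrableOn_integral_norm_sq
  have hrep : ∀ᵐ s ∂(volume : Measure ℝ), s ∈ Ioo 0 T → Et s = E s := by
    filter_upwards [hEq', hEle'] with s hs hs' hsI
    rw [hEt]
    simp only
    rw [hs hsI, ENNReal.toReal_ofReal (by linarith [hs' hsI])]
    ring
  -- ### conclude at a.e. `t`
  filter_upwards [hEq, (ae_restrict_iff' measurableSet_Ioo).2 hrep, ae_restrict_mem measurableSet_Ioo] with t ht hrept htI
  have hEt_t : Et t = E t := hrept
  -- finiteness of the partial integrals up to `t`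
  have hIt : ∫⁻ s in Ioc 0 t, Qs s ≠ ⊤ := by rw [ht]; exact ENNReal.ofReal_ne_top
  have hIfin : ∀ s, s ≤ t → ∫⁻ r in Ioc 0 s, Qs r ≠ ⊤ := fun s hs =>
    ne_top_of_le_ne_top hIt (lintegral_mono_set (Ioc_subset_Ioc_right hs))
  -- `Et` is nonincreasing on `[0, t]`
  have hanti : AntitoneOn Et (Icc 0 t) := by
    intro s₁ hs₁ s₂ hs₂ h12
    simp only [hEt]
    have hmono : ∫⁻ r in Ioc 0 s₁, Qs r ≤ ∫⁻ r in Ioc 0 s₂, Qs r := lintegral_mono_set (Ioc_subset_Ioc_right h12)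
    have := ENNReal.toReal_mono (hIfin s₂ hs₂.2) hmono
    linarith
  -- the two-point inequality
  have htwo : ∀ s₁ s₂, 0 ≤ s₁ → s₁ ≤ s₂ → s₂ ≤ t → Et s₂ * (1 + κ * (s₂ - s₁)) ≤ Et s₁ := by
    intro s₁ s₂ h0 h12 h2t
    have hsubI : Ioc s₁ s₂ ⊆ Ioo 0 T := fun r hr => ⟨h0.trans_lt hr.1, hr.2.trans_lt (h2t.trans_lt htI.2)⟩
    -- split the partial integral
    have hsplit : ∫⁻ r in Ioc 0 s₂, Qs r = (∫⁻ r in Ioc 0 s₁, Qs r) + ∫⁻ r in Ioc s₁ s₂, Qs r := by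
      rw [← lintegral_union measurableSet_Ioc (Ioc_disjoint_Ioc_of_le le_rfl), Ioc_union_Ioc_eq_Ioc h0 h12]
    have hfin2 := hIfin s₂ h2t
    have hfin12 : ∫⁻ r in Ioc s₁ s₂, Qs r ≠ ⊤ :=
      ne_top_of_le_ne_top hfin2 (by rw [hsplit]; exact le_add_self)
    have hdiff : Et s₁ - Et s₂ = 2 * (∫⁻ r in Ioc s₁ s₂, Qs r).toReal := by
      simp only [hEt]
      rw [hsplit, ENNReal.toReal_add (hIfin s₁ (h12.trans h2t)) hfin12]
      ring
    -- lower bound of the middle integral by the energy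
    have hEI : IntegrableOn (fun r => κ / 2 * E r) (Ioc s₁ s₂) := (hEint.mono_set hsubI).const_mul _
    have hlowI : ENNReal.ofReal (∫ r in Ioc s₁ s₂, κ / 2 * E r) ≤ ∫⁻ r in Ioc s₁ s₂, Qs r := by
      rw [ofReal_integral_eq_lintegral_ofReal hEI
        (ae_of_all _ fun r => mul_nonneg (by positivity) (integral_nonneg fun x => sq_nonneg _))]
      refine lintegral_mono_ae ((ae_restrict_iff' measurableSet_Ioc).2 (hlow'.mono fun r hr hrI => hr (hsubI hrI)))
    have hlowR : ∫ r in Ioc s₁ s₂, κ / 2 * E r ≤ (∫⁻ r in Ioc s₁ s₂, Qs r).toReal := by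
      have := ENNReal.toReal_mono hfin12 hlowI
      rwa [ENNReal.toReal_ofReal (setIntegral_nonneg measurableSet_Ioc fun r _ =>
        mul_nonneg (by positivity) (integral_nonneg fun x => sq_nonneg _))] at this
    -- replace `E` by `Et` inside the integral and use monotonicity
    have hEtI : IntegrableOn Et (Ioc s₁ s₂) :=
      ((hanti.mono (Icc_subset_Icc h0 h2t)).integrableOn_isCompact isCompact_Icc).mono_set Ioc_subset_Icc_self
    have hrepI : ∫ r in Ioc s₁ s₂, κ / 2 * E r = ∫ r in Ioc s₁ s₂, κ / 2 * Et r := by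
      refine setIntegral_congr_ae measurableSet_Ioc ?_
      filter_upwards [hrep] with r hr hrI
      rw [hr (hsubI hrI)]
    have hmonoI : ∫ r in Ioc s₁ s₂, κ / 2 * Et s₂ ≤ ∫ r in Ioc s₁ s₂, κ / 2 * Et r := by
      refine setIntegral_mono_on (integrableOn_const (by rw [Real.volume_Ioc]; exact ENNReal.ofReal_ne_top))
        (hEtI.const_mul _) measurableSet_Ioc fun r hr => ?_
      exact mul_le_mul_of_nonneg_left
        (hanti ⟨h0.trans hr.1.le, hr.2.trans h2t⟩ ⟨h0.trans h12, h2t⟩ hr.2) (by positivity)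
    have hconst : ∫ r in Ioc s₁ s₂, κ / 2 * Et s₂ = (s₂ - s₁) * (κ / 2 * Et s₂) := by
      rw [setIntegral_const, smul_eq_mul, measureReal_def, Real.volume_Ioc, ENNReal.toReal_ofReal (by linarith)]
    -- assemble
    have key : (s₂ - s₁) * (κ / 2 * Et s₂) ≤ (Et s₁ - Et s₂) / 2 := by
      rw [hdiff]
      linarith [hmonoI, hlowR, hrepI, hconst]
    nlinarith [key]
  -- the decay of the representative
  have hdec := le_mul_exp_neg_of_two_point_cf (g := Et) hκ0 htI.1.le htwo
  have hEt0 : Et 0 = E₀ := by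
    simp only [hEt]
    rw [Ioc_self, Measure.restrict_empty, lintegral_zero_measure, ENNReal.toReal_zero, mul_zero, sub_zero]
  rw [hEt_t, hEt0] at hdec
  calc E t ≤ E₀ * Real.exp (-(κ * t)) := hdec
    _ = Real.exp (-(8 * Real.pi ^ 2 * (lo * c) * t)) * E₀ := by rw [hκ, mul_comm]

end IsWeakTensorPassiveVectorDistortedOn

end Torus

end Literature.Analysis.FluidPDE

end
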